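import Literature.MathematicalPhysics.QuantumFieldTheory.Volkov2020.ProjectorVanishingLemma
import Literature.MathematicalPhysics.QuantumFieldTheory.Volkov2020.MomentumRouting
import HarnessLib

/-!
# Volkov 2020 (NPB 961, 115232) §3.3: **LEMMA 3.9 (3.11) HYPOTHESIS-FREE ON EDGE LISTS CONTRIBUTING TO THE AMM, MODULO 𝒫** — the slot vectors Q′_l = Q_l(z)/D(z) AS PRINTED (§2.2.1's p[T] routing of B.40/B.44, `Volkov2020.MomentumRouting` r3) fed into B.48's `abs_projector_le_parametric` (`Volkov2020.ProjectorVanishingLemma` r3): for EVERY AMM edge list (vertices 0…V on the lepton path, lepton lines lep m : m → m+1, every other line a photon a → b with a ≤ b, at least one photon, external photon at the vertex vμ), every z > 0, every Clifford family in a normed real algebra, m ≠ 0, p₁² = p₂² = m², and every admissible bounded 𝒫: |𝒫[X(z)]| ≤ N·assemblyConst(2(#1-trees − 1)(l1 p₁ + l1 p₂))·max_{i∈Ph(E(G))} z′_i/max(z′_i, z_i) — PROVED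

independent recomputation; certified where stated, statistical where stated; no new-physics claim.

CITATION HEADER (venture `QEDPrecision`, cell `pub-qed`, track TROPICAL seat V3b = `pub-qed-trop-v3-lit-2` gen 13; the declarations were written and
dev-validated by gen 12 as «§11» of `ProjectorVanishingLemma.lean` and are filed here UNCHANGED as their own module so that neither 900-line parent is
re-issued; VALUE-FREE: an inequality between printed formulas for arbitrary edge lists — nothing of X352, nothing per word). JOINS the two r3 files:
`Volkov2020.ProjectorVanishingLemma` (B.39/B.47/B.48: Lemma 3.8; Lemma 3.9 modulo 𝒫 with the constant explicit, `abs_projector_le`; (3.11) for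
PARAMETRIC slot vectors, `ParametricSlot`, `slotK`, `exchBound`, `abs_projector_le_parametric`) and `Volkov2020.MomentumRouting` (B.40/B.44/B.45:
§2.2.1's p[T] AS PRINTED on edge lists, `momentumThrough`, `ammExt`, `routingCoeff`, `qLine`, `lpathOf`, `momentumThrough_path`,
`abs_routingCoeff_le_one`, …), over B.31/B.38's `Volkov2020.ProjectorTreeExchange` (`cycleMatroid`, `oneTrees`, `treeSum`, `qCoeff`,
`isBase_cycleMatroid_path`, `mem_closure_cycleMatroid_of_path`). Serves §B.53 of `tropical/view/V3-VOLKOV-DEGREES.md`.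

Source. [Volkov2020] S. Volkov, "Infrared and ultraviolet power counting on the mass shell in quantum electrodynamics", Nucl. Phys. B 961
(2020) 115232 = arXiv:1912.04885v4 (e-print tex `iclos_arxiv.tex`, sha256 8613757ca2360833…, held by the cell under
`pub-qed-trop-v3-lit-2/sources/arxiv-1912.04885/`; numbering by section = the journal's), VERBATIM:
* §2.2.1 (journal p.8; tex l.226–239): "The multiplier m + Q̂_l(z)/D(z) corresponds to each unpaired internal lepton line l. Here
  Q_l(z) = Σ_T p[T] ∏_{l′∈E(G)∖T} z_{l′}, where the summation goes over all 1-trees T containing l, by p[T] we denote the momentum that passes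
  through l in T; it is defined as the sum of the external momenta of G outgoing from the connectivity component of T∖l to which the line l is
  directed." and (tex l.213–218) "D(z) = Σ_T ∏_{l∈E(G)∖T} z_l, the summation goes over all 1-trees in G."
* Lemma 3.9 (journal p.16; tex l.525–531): "… Then |𝒫X| ≤ C · max_{i∈Ph(E(G))} z′_i/max(z′_i, z_i), where C > 0 does not depend on z; z′_i are
  defined in Lemma 3.4." and its proof (journal p.16–17; tex l.537–559): "Q̂′_l = Q̂_l(z)/D(z) … q_l = p₁ for 1 ≤ l ≤ h and q_l = p₂ for
  h+1 ≤ l ≤ 2h … Q″_l = Q′_l − q_l … Q″_l = (Q_l(z) − q_l D(z))/D(z). Both terms of the numerator can be expressed as sums of the form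
  Σ_T c(T)∏_{l∈E(G)∖T} z_l, where the summation goes over 1-trees T of G, the coefficients c(T) are linear combinations of p₁, p₂ … The terms
  corresponding to T are cancelled if l ∈ T and the momentum passing through l in T equals q_l …"

READING / MODELLING (flagged, as in the parents). «AMM edge list» = B.40's combinatorial model of a graph of §2.1 without lepton loops: vertices
0,…,V on the lepton path, the lepton line lep m joining m and m+1, every other internal line a photon (a, b) with a ≤ b, the external lepton momenta
p₁ in at 0 and p₂ out at V, the external photon's p₁ − p₂ out at vμ (`ammExt`); the |P| = 0 numerator word X and the functional 𝒫 are EXACTLY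
B.47/B.48's (`E`, `wordQ`; 𝒫 any ℝ-linear functional killing A(p̂₁ − m), (p̂₂ − m)A and γ_μ with |𝒫x| ≤ N‖x‖ — NOT the paper's form-factor projector,
whose identification with these objects is §2.2's construction and is not a kernel object here, see B.51). Lemma 3.9's «z′_i are defined in
Lemma 3.4» (the source's `\ref{lemma_w}`; the parents' r2 header quotes it with the slip «Lemma 3.7» — corrected here, no statement affected):
z′_i = max_{l∈LPath(i)} z_l = B.38's `lineMax`, inside `exchBound`.

WHAT THE KERNEL CERTIFIES (all PROVED; Mathlib + the two parents only; no named fact, D-0026 net debt 0):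
* `slotVec` — Q′_l = Q_l(z)/D(z) AS PRINTED as a 4-vector (Σ over the 1-trees containing l of (∏_{k∉T} z_k)·p[T], times D(z)⁻¹), with B.40's
  `momentumThrough` and `ammExt`; `momentumThrough_eq_routingCoeff` (p[T] = c₀(T)p₁ + c₁(T)p₂ with B.44's integer `routingCoeff`);
  `qLine_eq_coords`; `treeSum_pos_amm` (D(z) > 0 for z > 0: the lepton path is a 1-tree);
* **`slotVec_sub_qLine`** — Q′_l − q_l = Σ_{j∈{0,1}} qCoeff_j • p_j, i.e. the printed Q″_l = (Q_l − q_l D)/D written coordinate-wise with B.38's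
  `qCoeff` (the object bounded by `abs_qCoeff_le`) and B.44's routing coefficients;
* **`parametricSlot_amm`** — every lepton line's AS-PRINTED slot vector is a `ParametricSlot` of B.48 (inputs: B.44's |c_j(T)| ≤ 1,
  |coordinates of q_l| ≤ 1, and the printed cancellation p[Lept] = q_l = B.40's `momentumThrough_path`); `amm_inputs` — the four graph inputs of
  B.31/B.38 (photons = the non-lepton lines; Lept is a base of the cycle matroid; lepton paths lie in Lept and span their photon), discharged for
  every AMM edge list by B.31 §5's `isBase_cycleMatroid_path` / `mem_closure_cycleMatroid_of_path`;
* **`abs_projector_le_amm`** — the display above: B.48's `abs_projector_le_parametric` with every graph-side hypothesis DISCHARGED; what remains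
  quantified is only the algebra A, the Clifford family, m ≠ 0 with p₁² = p₂² = m², z > 0, the tensor-name bookkeeping of the word (each name twice,
  left slots after vμ carry q = p₂, right slots before vμ carry q = p₁ — AS PRINTED), and 𝒫 with its norm bound N.
NOT claimed (unchanged from B.48/B.51): that X is THE |P| = 0 Feynman-parametric numerator of §2.2 for the graph (the Schwinger-parametric
derivation is not formalised), the identification of 𝒫 and N with the form-factor projector, Lemma 3.9 for |P| ≥ 1 words (the paper's (3.11) is
stated for the |P| = 0 terms it is used on, (3.12)–(3.13), B.41), anything per word of the cell; nothing of X352.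
-/


namespace Literature.MathematicalPhysics.QuantumFieldTheory.Volkov2020

namespace ProjectorVanishing

open AppendixNumerators Letter Finset

/-! ## §1 (3.11) HYPOTHESIS-FREE ON EDGE LISTS CONTRIBUTING TO THE AMM: the slot vectors Q′_l = Q_l(z)/D(z) AS PRINTED, with B.40's p[T] and q_l
(gen 12's dev-validated «§11» of `ProjectorVanishingLemma.lean`, byte-identical below this line) -/

section AMM

variable {A : Type*} [NormedRing A] [NormedAlgebra ℝ A] [NormOneClass A]
variable (C : Ctx A) {ι : Type*} [DecidableEq ι] {N V : ℕ}

/-- **Q′_l = Q_l(z)/D(z) AS PRINTED, as a 4-vector**: Q_l(z) = Σ_{T ∋ l} p[T]·∏_{k∈E(G)∖T} z_k over the 1-trees containing l, with the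
momentum p[T] through l in T for the AMM external momenta (p₁ in at the vertex 0, p₂ out at V, the photon's p₁ − p₂ out at vμ), divided
by D(z) = Σ_T ∏_{k∉T} z_k. [cite: Volkov2020, §2.2.1 «Q_l(z) = Σ_T p[T] ∏_{l′∈E(G)∖T} z_{l′}, where the summation goes over all 1-trees T containing l» and «m + Q̂_l(z)/D(z)» (journal p.8; arXiv:1912.04885v4 tex l.226–239); proof of Lemma 3.9 «Q̂′_l = Q̂_l(z)/D(z)» (journal p.16; tex l.537)] -/
noncomputable def slotVec (G : Fin N → Fin (V + 1) × Fin (V + 1)) (vμ : Fin (V + 1)) (z : Fin N → ℝ) (l : Fin N) : Fin 4 → ℝ :=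
  (treeSum (cycleMatroid G) z)⁻¹ •
    ∑ T ∈ (oneTrees (cycleMatroid G)).filter (fun T => l ∈ T),
      (∏ k ∈ univ \ T, z k) • momentumThrough G (ammExt V C.p₁ C.p₂ vμ) T l

omit [NormOneClass A] [DecidableEq ι] in
/-- p[T] in the basis p₁, p₂ with B.40's coordinates. [cite: Volkov2020, proof of Lemma 3.9 «the coefficients c(T) are linear combinations of p₁, p₂» (journal p.16; arXiv:1912.04885v4 tex l.544–545)] -/
theorem momentumThrough_eq_routingCoeff (G : Fin N → Fin (V + 1) × Fin (V + 1)) (vμ : Fin (V + 1)) (T : Finset (Fin N)) (l : Fin N) :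
    momentumThrough G (ammExt V C.p₁ C.p₂ vμ) T l = routingCoeff G vμ l 0 T • C.p₁ + routingCoeff G vμ l 1 T • C.p₂ := by
  rw [momentumThrough_eq_coeffs, (routingCoeff_eq_momentumCoeffs G vμ l T).1, (routingCoeff_eq_momentumCoeffs G vμ l T).2,
    Int.cast_smul_eq_zsmul, Int.cast_smul_eq_zsmul]

omit [NormOneClass A] [DecidableEq ι] in
/-- q_l in the basis p₁, p₂. [cite: Volkov2020, proof of Lemma 3.9 «q_l = p₁ for 1 ≤ l ≤ h and q_l = p₂ for h+1 ≤ l ≤ 2h» (journal p.16; arXiv:1912.04885v4 tex l.541)] -/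
theorem qLine_eq_coords (vμ : Fin (V + 1)) (m : Fin V) :
    qLine C.p₁ C.p₂ vμ m =
      qLine (stdMomentum 0) (stdMomentum 1) vμ m 0 • C.p₁ + qLine (stdMomentum 0) (stdMomentum 1) vμ m 1 • C.p₂ := by
  unfold qLine
  split_ifs <;> simp [stdMomentum]

omit [NormOneClass A] [DecidableEq ι] in
/-- D(z) > 0 on an AMM edge list with positive parameters (the lepton tree contributes a positive monomial).
[cite: Volkov2020, §2.2.1 «D(z) = Σ_T ∏ z» (journal p.8; arXiv:1912.04885v4 tex l.213–218)] -/
theorem treeSum_pos_amm (G : Fin N → Fin (V + 1) × Fin (V + 1)) (lep : Fin V → Fin N)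
    (hlep : ∀ m : Fin V, ((G (lep m)).1 : ℕ) = m ∧ ((G (lep m)).2 : ℕ) = m + 1) (z : Fin N → ℝ) (hz : ∀ k, 0 < z k) :
    0 < treeSum (cycleMatroid G) z := by
  have hLept : (cycleMatroid G).IsBase (((univ.image lep : Finset (Fin N))) : Set (Fin N)) := by
    rw [coe_image, coe_univ, Set.image_univ]
    exact isBase_cycleMatroid_path G lep (lep_injective hlep) hlep
  unfold treeSum
  exact lt_of_lt_of_le (prod_pos fun k _ => hz k)
    (single_le_sum (f := fun S : Finset (Fin N) => ∏ k ∈ univ \ S, z k) (fun S _ => prod_nonneg fun k _ => (hz k).le)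
      ((mem_oneTrees _).2 hLept))

omit [NormOneClass A] [DecidableEq ι] in
/-- **Q′_l − q_l = Q″_l written in the basis p₁, p₂ with B.38's `qCoeff` and B.40's coordinates** (the identity behind `ParametricSlot`).
[cite: Volkov2020, proof of Lemma 3.9 «Q″_l = Q′_l − q_l … Q″_l = (Q_l(z) − q_l D(z))/D(z)» (journal p.16; arXiv:1912.04885v4 tex l.539, l.544–546)] -/
theorem slotVec_sub_qLine (G : Fin N → Fin (V + 1) × Fin (V + 1)) (lep : Fin V → Fin N)
    (hlep : ∀ m : Fin V, ((G (lep m)).1 : ℕ) = m ∧ ((G (lep m)).2 : ℕ) = m + 1) (vμ : Fin (V + 1))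
    (z : Fin N → ℝ) (hz : ∀ k, 0 < z k) (m : Fin V) :
    slotVec C G vμ z (lep m) - qLine C.p₁ C.p₂ vμ m =
      qCoeff (cycleMatroid G) z (lep m) (routingCoeff G vμ (lep m) 0) (qLine (stdMomentum 0) (stdMomentum 1) vμ m 0) • C.p₁ +
      qCoeff (cycleMatroid G) z (lep m) (routingCoeff G vμ (lep m) 1) (qLine (stdMomentum 0) (stdMomentum 1) vμ m 1) • C.p₂ := by
  have hD : treeSum (cycleMatroid G) z ≠ 0 := (treeSum_pos_amm G lep hlep z hz).ne'
  set S := (oneTrees (cycleMatroid G)).filter (fun T => lep m ∈ T) with hS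
  have hsum : ∑ T ∈ S, (∏ k ∈ univ \ T, z k) • momentumThrough G (ammExt V C.p₁ C.p₂ vμ) T (lep m) =
      (∑ T ∈ S, routingCoeff G vμ (lep m) 0 T * ∏ k ∈ univ \ T, z k) • C.p₁ +
      (∑ T ∈ S, routingCoeff G vμ (lep m) 1 T * ∏ k ∈ univ \ T, z k) • C.p₂ := by
    rw [sum_smul, sum_smul, ← sum_add_distrib]
    refine sum_congr rfl fun T _ => ?_
    rw [momentumThrough_eq_routingCoeff, smul_add, smul_smul, smul_smul, mul_comm, mul_comm (∏ k ∈ univ \ T, z k)]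
  unfold slotVec qCoeff
  rw [← hS, hsum, qLine_eq_coords C vμ m, smul_add, smul_smul, smul_smul, sub_div, sub_div, mul_div_assoc, mul_div_assoc,
    div_self hD, mul_one, mul_one, sub_smul, sub_smul, div_eq_inv_mul, div_eq_inv_mul]
  abel

omit [NormOneClass A] [DecidableEq ι] in
/-- **Every lepton line's AS-PRINTED slot vector is a parametric slot** (B.40's |c(T)| ≤ 1, |coordinates of q_l| ≤ 1 and the cancellation
p[Lept] = q_l feed `ParametricSlot`). [cite: Volkov2020, proof of Lemma 3.9 (journal p.16–17; arXiv:1912.04885v4 tex l.541–549)] -/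
theorem parametricSlot_amm (G : Fin N → Fin (V + 1) × Fin (V + 1)) (lep : Fin V → Fin N)
    (hlep : ∀ m : Fin V, ((G (lep m)).1 : ℕ) = m ∧ ((G (lep m)).2 : ℕ) = m + 1) (vμ : Fin (V + 1))
    (z : Fin N → ℝ) (hz : ∀ k, 0 < z k) (m : Fin V) :
    ParametricSlot C (cycleMatroid G) z (univ.image lep) (qLine C.p₁ C.p₂ vμ m) (slotVec C G vμ z (lep m)) := by
  refine ⟨lep m, mem_image_of_mem _ (mem_univ m), routingCoeff G vμ (lep m) 0, routingCoeff G vμ (lep m) 1,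
    qLine (stdMomentum 0) (stdMomentum 1) vμ m 0, qLine (stdMomentum 0) (stdMomentum 1) vμ m 1,
    abs_routingCoeff_le_one G vμ (lep m) 0, abs_qLine_apply_le_one vμ m 0, ?_,
    abs_routingCoeff_le_one G vμ (lep m) 1, abs_qLine_apply_le_one vμ m 1, ?_,
    slotVec_sub_qLine C G lep hlep vμ z hz m⟩ <;>
  · unfold routingCoeff; rw [momentumThrough_path _ _ vμ hlep m]

omit [NormOneClass A] [DecidableEq ι] in
/-- The graph inputs of B.31/B.38 for an AMM edge list: every non-lepton line is a photon; Lept is a 1-tree; lepton paths lie in Lept and span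
their photon (cycle-matroid closure). [cite: Volkov2020, §2.1 «LPath(i)» and proof of Lemma 3.9 (journal p.7, p.17; arXiv:1912.04885v4 tex l.166–169, l.552–556)] -/
theorem amm_inputs (G : Fin N → Fin (V + 1) × Fin (V + 1)) (lep : Fin V → Fin N)
    (hlep : ∀ m : Fin V, ((G (lep m)).1 : ℕ) = m ∧ ((G (lep m)).2 : ℕ) = m + 1)
    (hph : ∀ i, i ∉ univ.image lep → ((G i).1 : ℕ) ≤ (G i).2) :
    (∀ l, l ∉ univ.image lep → l ∈ univ \ univ.image lep) ∧
    (cycleMatroid G).IsBase (((univ.image lep : Finset (Fin N))) : Set (Fin N)) ∧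
    (∀ i ∈ univ \ univ.image lep, lpathOf G lep i ⊆ univ.image lep) ∧
    (∀ i ∈ univ \ univ.image lep, i ∈ (cycleMatroid G).closure ((lpathOf G lep i : Finset (Fin N)) : Set (Fin N))) := by
  refine ⟨fun l hl => mem_sdiff.2 ⟨mem_univ _, hl⟩, ?_, fun i _ => lpathOf_subset G lep i, ?_⟩
  · rw [coe_image, coe_univ, Set.image_univ]
    exact isBase_cycleMatroid_path G lep (lep_injective hlep) hlep
  · intro i hi
    have hi' : i ∉ univ.image lep := (mem_sdiff.1 hi).2
    have hab := hph i hi'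
    have hbV : ((G i).2 : ℕ) ≤ V := Nat.le_of_lt_succ (G i).2.isLt
    refine mem_closure_cycleMatroid_of_path G hab rfl rfl (fun k => if h : k < V then lep ⟨k, h⟩ else i) ?_ (lpathOf G lep i) ?_
    · intro k hak hkb
      have hkV : k < V := lt_of_lt_of_le hkb hbV
      simp only [dif_pos hkV]
      exact hlep ⟨k, hkV⟩
    · intro k hak hkb
      have hkV : k < V := lt_of_lt_of_le hkb hbV
      simp only [dif_pos hkV]
      exact mem_image_of_mem _ (mem_filter.2 ⟨mem_univ _, hak, hkb⟩)

variable (hγ : IsDirac C.γ)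
include hγ

/-- **NPB 961 LEMMA 3.9 (3.11), HYPOTHESIS-FREE ON EDGE LISTS CONTRIBUTING TO THE AMM, MODULO 𝒫.** Vertices 0,…,V along the lepton path,
lepton lines lep m : m → m+1, every other line a photon a → b (a ≤ b), at least one photon, external photon at vμ, z > 0; X = the full
g-contraction of the |P| = 0 numerator word whose lepton slots (named by their lepton line m, those LEFT of γ_μ after the vertex vμ, those
RIGHT of it before vμ — AS PRINTED q_l = p₂ resp. p₁) carry m + Q̂′_l with Q′_l = Q_l(z)/D(z) AS PRINTED. Then for every Clifford family in a
normed real algebra, m ≠ 0, p₁² = p₂² = m², and every ℝ-linear 𝒫 killing A(p̂₁ − m), (p̂₂ − m)A and γ_μ with |𝒫x| ≤ N‖x‖: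
|𝒫[X]| ≤ N · assemblyConst(2(#1-trees − 1)(l1 p₁ + l1 p₂)) · max_{i∈Ph(E(G))} z′_i/max(z′_i, z_i).
[cite: Volkov2020, Lemma 3.9 eq. (3.11) and its proof (journal p.16–17; arXiv:1912.04885v4 tex l.525–559)] -/
theorem abs_projector_le_amm (hm : C.m ≠ 0) (h1 : dot C.p₁ C.p₁ = C.m ^ 2) (h2 : dot C.p₂ C.p₂ = C.m ^ 2)
    (G : Fin N → Fin (V + 1) × Fin (V + 1)) (lep : Fin V → Fin N)
    (hlep : ∀ m : Fin V, ((G (lep m)).1 : ℕ) = m ∧ ((G (lep m)).2 : ℕ) = m + 1)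
    (hph : ∀ i, i ∉ univ.image lep → ((G i).1 : ℕ) ≤ (G i).2) (hPh : (univ \ univ.image lep).Nonempty)
    (vμ : Fin (V + 1)) (z : Fin N → ℝ) (hz : ∀ k, 0 < z k)
    (Ls Rs : List (ι × Fin V)) (L : List ι) (hL : L.Nodup)
    (hnames : ∀ i, i ∈ L ↔ i ∈ Ls.map Prod.fst ++ Rs.map Prod.fst)
    (hcount : ∀ i ∈ Ls.map Prod.fst ++ Rs.map Prod.fst, (Ls.map Prod.fst ++ Rs.map Prod.fst).count i = 2)
    (hLs : ∀ im ∈ Ls, (vμ : ℕ) ≤ (im.2 : ℕ)) (hRs : ∀ jm ∈ Rs, (jm.2 : ℕ) < (vμ : ℕ))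
    (P : A →ₗ[ℝ] ℝ) (hP1 : ∀ U : A, P (U * (sl C.γ C.p₁ - C.m • (1 : A))) = 0)
    (hP2 : ∀ W : A, P ((sl C.γ C.p₂ - C.m • (1 : A)) * W) = 0) (hPμ : P (C.γ C.μ) = 0)
    {Nb : ℝ} (hN : ∀ x : A, |P x| ≤ Nb * ‖x‖) :
    |P (E C L (wordQ (Ls.map fun im => (im.1, slotVec C G vμ z (lep im.2)))
        (Rs.map fun jm => (jm.1, slotVec C G vμ z (lep jm.2)))))| ≤
      Nb * (assemblyConst C (slotK C (cycleMatroid G)) L.length Ls.length Rs.length *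
        exchBound z (univ \ univ.image lep) hPh (lpathOf G lep)) := by
  obtain ⟨hcover, hLept, hsub, hcl⟩ := amm_inputs G lep hlep hph
  have eL : (Ls.map fun im => (im.1, slotVec C G vμ z (lep im.2))).map Prod.fst = Ls.map Prod.fst := by
    rw [List.map_map]; rfl
  have eR : (Rs.map fun jm => (jm.1, slotVec C G vμ z (lep jm.2))).map Prod.fst = Rs.map Prod.fst := by
    rw [List.map_map]; rfl
  have hq₂ : ∀ im ∈ Ls, qLine C.p₁ C.p₂ vμ im.2 = C.p₂ := fun im him => by
    unfold qLine; rw [if_neg (not_lt.2 (hLs im him))]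
  have hq₁ : ∀ jm ∈ Rs, qLine C.p₁ C.p₂ vμ jm.2 = C.p₁ := fun jm hjm => by
    unfold qLine; rw [if_pos (hRs jm hjm)]
  have hLs' : ∀ iq ∈ (Ls.map fun im => (im.1, slotVec C G vμ z (lep im.2))),
      ParametricSlot C (cycleMatroid G) z (univ.image lep) C.p₂ iq.2 := by
    intro iq hiq
    obtain ⟨im, him, rfl⟩ := List.mem_map.1 hiq
    have h := parametricSlot_amm C G lep hlep vμ z hz im.2
    rwa [hq₂ im him] at h
  have hRs' : ∀ jq ∈ (Rs.map fun jm => (jm.1, slotVec C G vμ z (lep jm.2))),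
      ParametricSlot C (cycleMatroid G) z (univ.image lep) C.p₁ jq.2 := by
    intro jq hjq
    obtain ⟨jm, hjm, rfl⟩ := List.mem_map.1 hjq
    have h := parametricSlot_amm C G lep hlep vμ z hz jm.2
    rwa [hq₁ jm hjm] at h
  have h := abs_projector_le_parametric C hγ hm h1 h2 (cycleMatroid G) z hz (univ \ univ.image lep) (univ.image lep) (lpathOf G lep)
    hcover hLept hsub hcl hPh _ _ L hL (by rw [eL, eR]; exact hnames) (by rw [eL, eR]; exact hcount) hLs' hRs' P hP1 hP2 hPμ hN
  simpa only [List.length_map] using h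

end AMM

end ProjectorVanishing

end Literature.MathematicalPhysics.QuantumFieldTheory.Volkov2020
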